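import Summits.NavierStokesRegularity.NavierStokesRegularity.Theorems.StretchingWellBindingEnstrophyQuarterLawSparsenessTypeIGate
import Summits.NavierStokesRegularity.NavierStokesRegularity.Theorems.ProductionEfficiencyDecay.Negative.ProductionEfficiencyDecayFalseOfDssLerayHopfBlowup
import Summits.NavierStokesRegularity.NavierStokesRegularity.Theorems.EfficiencyFloorAssembly
import Summits.NavierStokesRegularity.NavierStokesRegularity.Theorems.TypeIQuarterGateLorentzUpgradeIffQuarterLaw
import Summits.NavierStokesRegularity.NavierStokesRegularity.Theses.EfficiencyFloor
import Summits.NavierStokesRegularity.NavierStokesRegularity.Theses.TypeIQuarterGate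
import Summits.NavierStokesRegularity.NavierStokesRegularity.Theses.TypeILiouville
import HarnessLib

/-!
# Crux `EfficiencyFloor.ProductionEfficiencyDecay` (stmt-NavierStokesRegularity-22866):
# decaying efficiency forces TYPE II — against route TypeIQuarterGate's cruxes and the 1574 line's S2

Helper file (`--supports stmt-NavierStokesRegularity-22866`; closes no registered stub — the only active stub
`stub_depletionGivenBudget` of `Cruxes/ProductionEfficiencyDecay/Lines/efficiency_floor.lean` IS the crux, p585755).
What the crux BUYS per blow-up, stated against the registered vocabulary of the neighbouring routes:

* PER SOLUTION. `not_sliceQuarterLaw_of_efficiencyDecayLaw`: a first blow-up obeying the crux's ε-law (efficiency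
  decay on a late window, every ε) does NOT blow up at Leray's enstrophy rate (`¬ ∃ K, Z ≤ K/√(T − t)`;
  the per-solution super-Leray floor is the tree's `ProductionEfficiencyDecayNegative.floor_eventually_of_window_law`).
  Hence `not_isTypeIBlowup_of_efficiencyDecayLaw_of_uniformSparseness`: **decaying efficiency ∧ uniform sparseness
  (S2 of the 1574 line) ⟹ the blow-up is TYPE II** (sup-norm), and `not_uniformSparseness_of_efficiencyDecayLaw_of_isTypeIBlowup`:
  **a Type-I blow-up with decaying efficiency carries satellite swarms** (¬ S2) — by
  `FiniteSingularSet.sliceQuarterLaw_of_isTypeIBlowup_of_uniformSparseness`.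
* BY NAME. `typeII_only_of_productionEfficiencyDecay_of_quarterLawTypeI`: `ProductionEfficiencyDecay ∧ QuarterLawTypeI`
  (23726) ⟹ every first blow-up is Type II; likewise with `LorentzUpgradeTypeI` (24108) or with the 1574 line's
  `stub_uniformSparseness` in place of `QuarterLawTypeI`. With `TypeIliouvilleNoTypeII` (0056) on top, no first
  blow-up exists and the route's assembly fires: `navierStokesRegularity_of_productionEfficiencyDecay_of_noTypeII_of_stub_uniformSparseness`
  (PED ∧ 0056 ∧ (∀ S2) ⟹ `NavierStokesRegularity`, through `Registered.enstrophyQuarterLaw_of_stubs` and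
  `efficiencyFloor_assembly_proof`).

HONEST FRAMING: implications between OPEN statements about hypothetical blow-ups (PED, 0056, 23726, 24108, S2 are
all open); the conditional `NavierStokesRegularity` certificate asserts none of its three hypotheses; no registered
stub or crux is closed; nothing here proves Navier–Stokes regularity.
-/

noncomputable section

-- the summit and its single sub-problem share the name (CONVENTIONS §1), as in every Theorems file
set_option linter.dupNamespace false

namespace Summit.NavierStokesRegularity.NavierStokesRegularity.Theorems.ProductionEfficiencyDecay.TypeIIOnly

open MeasureTheory Set Function Filter Topology Metric
open Literature.Analysis.FluidPDE
open Summit.NavierStokesRegularity.NavierStokesRegularity.Theorems.EnstrophyQuarterLaw.SparseSieve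
open scoped NNReal ENNReal

/-! ### Per solution -/

/-- **Decaying efficiency ⟹ not Leray-rate (one solution).** If a maximal smooth Leray–Hopf solution from a
rapidly decaying datum obeys the ε-law of `ProductionEfficiencyDecay` for every `ε > 0` (a late window with
`0 < Z < ∞` and `Z(s)⁻² − Z(t)⁻² ≤ ε(t − s)`), then its enstrophy admits NO bound `Z(t) ≤ K/√(T − t)` on `[0, T)`:
the super-Leray floor `K/√(T − t) < Z(t)` eventually (`ProductionEfficiencyDecayNegative.floor_eventually_of_window_law`)
meets the bound at a late time. [folklore] -/
theorem not_sliceQuarterLaw_of_efficiencyDecayLaw {ν T : ℝ} (hν : 0 < ν) (hT : 0 < T)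
    {u : ℝ → EuclideanSpace ℝ (Fin 3) → EuclideanSpace ℝ (Fin 3)} {p : ℝ → EuclideanSpace ℝ (Fin 3) → ℝ}
    (hmax : IsMaximalSmoothSolution ν 0 u p T) (hLH : IsLerayHopfOn T ν 0 (u 0) u)
    (hdec : HasRapidSpatialDecay (u 0))
    (hlaw : ∀ ε : ℝ, 0 < ε → ∃ t₁ ∈ Set.Ico 0 T, (∀ t ∈ Set.Ico t₁ T,
        0 < ∫⁻ x, ‖curl (u t) x‖ₑ ^ 2 ∧ ∫⁻ x, ‖curl (u t) x‖ₑ ^ 2 < ⊤) ∧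
        ∀ s t : ℝ, t₁ ≤ s → s ≤ t → t < T →
          ((∫⁻ x, ‖curl (u s) x‖ₑ ^ 2).toReal)⁻¹ ^ 2 - ((∫⁻ x, ‖curl (u t) x‖ₑ ^ 2).toReal)⁻¹ ^ 2 ≤
            ε * (t - s)) :
    ¬ ∃ K : ℝ, ∀ t ∈ Ico 0 T, ∫⁻ x, ‖curl (u t) x‖ₑ ^ 2 ≤ ENNReal.ofReal (K / Real.sqrt (T - t)) := by
  rintro ⟨K, hK⟩
  have hfloor := ProductionEfficiencyDecayNegative.floor_eventually_of_window_law hν hT hmax hLH hdec hlaw K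
  obtain ⟨t, hlt, ht⟩ := (hfloor.and (Ioo_mem_nhdsLT hT)).exists
  exact (not_lt.2 (hK t ⟨ht.1.le, ht.2⟩)) hlt

/-- **Decaying efficiency ∧ uniform sparseness ⟹ TYPE II (one solution).** A first blow-up obeying the ε-law of
`ProductionEfficiencyDecay` whose slices are uniformly sparse (`UniformSparseness T u`, stub S2 of the 1574 line)
is NOT a sup-norm Type-I blow-up — on the Type-I stratum S2 gives Leray's rate
(`FiniteSingularSet.sliceQuarterLaw_of_isTypeIBlowup_of_uniformSparseness`), which decaying efficiency forbids.
[folklore] -/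
theorem not_isTypeIBlowup_of_efficiencyDecayLaw_of_uniformSparseness {ν T : ℝ} (hν : 0 < ν) (hT : 0 < T)
    {u : ℝ → EuclideanSpace ℝ (Fin 3) → EuclideanSpace ℝ (Fin 3)} {p : ℝ → EuclideanSpace ℝ (Fin 3) → ℝ}
    (hmax : IsMaximalSmoothSolution ν 0 u p T) (hLH : IsLerayHopfOn T ν 0 (u 0) u)
    (hdec : HasRapidSpatialDecay (u 0))
    (hlaw : ∀ ε : ℝ, 0 < ε → ∃ t₁ ∈ Set.Ico 0 T, (∀ t ∈ Set.Ico t₁ T,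
        0 < ∫⁻ x, ‖curl (u t) x‖ₑ ^ 2 ∧ ∫⁻ x, ‖curl (u t) x‖ₑ ^ 2 < ⊤) ∧
        ∀ s t : ℝ, t₁ ≤ s → s ≤ t → t < T →
          ((∫⁻ x, ‖curl (u s) x‖ₑ ^ 2).toReal)⁻¹ ^ 2 - ((∫⁻ x, ‖curl (u t) x‖ₑ ^ 2).toReal)⁻¹ ^ 2 ≤
            ε * (t - s))
    (hS : UniformSparseness T u) : ¬ IsTypeIBlowup u T := fun hI =>
  not_sliceQuarterLaw_of_efficiencyDecayLaw hν hT hmax hLH hdec hlaw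
    (FiniteSingularSet.sliceQuarterLaw_of_isTypeIBlowup_of_uniformSparseness hν hT hmax hLH hdec hI hS)

/-- **A Type-I blow-up with decaying efficiency carries satellite swarms** (one solution): under the ε-law of
`ProductionEfficiencyDecay` and the sup-norm Type-I rate, `UniformSparseness T u` fails. [folklore] -/
theorem not_uniformSparseness_of_efficiencyDecayLaw_of_isTypeIBlowup {ν T : ℝ} (hν : 0 < ν) (hT : 0 < T)
    {u : ℝ → EuclideanSpace ℝ (Fin 3) → EuclideanSpace ℝ (Fin 3)} {p : ℝ → EuclideanSpace ℝ (Fin 3) → ℝ}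
    (hmax : IsMaximalSmoothSolution ν 0 u p T) (hLH : IsLerayHopfOn T ν 0 (u 0) u)
    (hdec : HasRapidSpatialDecay (u 0))
    (hlaw : ∀ ε : ℝ, 0 < ε → ∃ t₁ ∈ Set.Ico 0 T, (∀ t ∈ Set.Ico t₁ T,
        0 < ∫⁻ x, ‖curl (u t) x‖ₑ ^ 2 ∧ ∫⁻ x, ‖curl (u t) x‖ₑ ^ 2 < ⊤) ∧
        ∀ s t : ℝ, t₁ ≤ s → s ≤ t → t < T →
          ((∫⁻ x, ‖curl (u s) x‖ₑ ^ 2).toReal)⁻¹ ^ 2 - ((∫⁻ x, ‖curl (u t) x‖ₑ ^ 2).toReal)⁻¹ ^ 2 ≤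
            ε * (t - s))
    (hI : IsTypeIBlowup u T) : ¬ UniformSparseness T u := fun hS =>
  not_isTypeIBlowup_of_efficiencyDecayLaw_of_uniformSparseness hν hT hmax hLH hdec hlaw hS hI

/-! ### By name -/

/-- **`ProductionEfficiencyDecay ∧ QuarterLawTypeI` (stmt-23726) ⟹ every first blow-up is TYPE II.** The crux of
route EfficiencyFloor makes the crux of route TypeIQuarterGate a Type-II certificate: a Type-I first blow-up would be
Leray-rate by `QuarterLawTypeI` and super-Leray by PED. Implication between OPEN statements. [folklore] -/
theorem typeII_only_of_productionEfficiencyDecay_of_quarterLawTypeI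
    (hPED : Summit.NavierStokesRegularity.NavierStokesRegularity.Theses.EfficiencyFloor.ProductionEfficiencyDecay)
    (hK1 : Summit.NavierStokesRegularity.NavierStokesRegularity.Theses.TypeIQuarterGate.QuarterLawTypeI)
    {ν T : ℝ} (hν : 0 < ν) (hT : 0 < T)
    {u : ℝ → EuclideanSpace ℝ (Fin 3) → EuclideanSpace ℝ (Fin 3)} {p : ℝ → EuclideanSpace ℝ (Fin 3) → ℝ}
    (hmax : IsMaximalSmoothSolution ν 0 u p T) (hLH : IsLerayHopfOn T ν 0 (u 0) u)
    (hdec : HasRapidSpatialDecay (u 0)) : ¬ IsTypeIBlowup u T := fun hI =>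
  not_sliceQuarterLaw_of_efficiencyDecayLaw hν hT hmax hLH hdec (hPED ν T hν hT u p hmax hLH hdec)
    (hK1 ν T hν hT u p hmax hLH hdec hI)

/-- **`ProductionEfficiencyDecay ∧ LorentzUpgradeTypeI` (stmt-24108, the active stub of 23726's skeleton) ⟹ every
first blow-up is TYPE II**, through the tree's `LorentzUpgradeTypeI ⟺ QuarterLawTypeI`. Implication between OPEN
statements. [folklore] -/
theorem typeII_only_of_productionEfficiencyDecay_of_lorentzUpgradeTypeI
    (hPED : Summit.NavierStokesRegularity.NavierStokesRegularity.Theses.EfficiencyFloor.ProductionEfficiencyDecay)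
    (hL : Summit.NavierStokesRegularity.NavierStokesRegularity.Theses.TypeIQuarterGate.LorentzUpgradeTypeI)
    {ν T : ℝ} (hν : 0 < ν) (hT : 0 < T)
    {u : ℝ → EuclideanSpace ℝ (Fin 3) → EuclideanSpace ℝ (Fin 3)} {p : ℝ → EuclideanSpace ℝ (Fin 3) → ℝ}
    (hmax : IsMaximalSmoothSolution ν 0 u p T) (hLH : IsLerayHopfOn T ν 0 (u 0) u)
    (hdec : HasRapidSpatialDecay (u 0)) : ¬ IsTypeIBlowup u T :=
  typeII_only_of_productionEfficiencyDecay_of_quarterLawTypeI hPED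
    (LorentzOfEnvelope.lorentzUpgradeTypeI_iff_quarterLawTypeI.1 hL) hν hT hmax hLH hdec

/-- **`ProductionEfficiencyDecay ∧ (∀ first blow-ups, S2)` ⟹ every first blow-up is TYPE II** — with the 1574
line's registered sparseness stub in place of `QuarterLawTypeI`
(`FiniteSingularSet.quarterLawTypeI_of_stub_uniformSparseness`). Implication between OPEN statements. [folklore] -/
theorem typeII_only_of_productionEfficiencyDecay_of_stub_uniformSparseness
    (hPED : Summit.NavierStokesRegularity.NavierStokesRegularity.Theses.EfficiencyFloor.ProductionEfficiencyDecay)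
    (hS2 : ∀ (ν T : ℝ), 0 < ν → 0 < T →
      ∀ (u : ℝ → EuclideanSpace ℝ (Fin 3) → EuclideanSpace ℝ (Fin 3))
        (p : ℝ → EuclideanSpace ℝ (Fin 3) → ℝ),
      IsMaximalSmoothSolution ν 0 u p T → IsLerayHopfOn T ν 0 (u 0) u →
      HasRapidSpatialDecay (u 0) → UniformSparseness T u)
    {ν T : ℝ} (hν : 0 < ν) (hT : 0 < T)
    {u : ℝ → EuclideanSpace ℝ (Fin 3) → EuclideanSpace ℝ (Fin 3)} {p : ℝ → EuclideanSpace ℝ (Fin 3) → ℝ}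
    (hmax : IsMaximalSmoothSolution ν 0 u p T) (hLH : IsLerayHopfOn T ν 0 (u 0) u)
    (hdec : HasRapidSpatialDecay (u 0)) : ¬ IsTypeIBlowup u T :=
  typeII_only_of_productionEfficiencyDecay_of_quarterLawTypeI hPED
    (FiniteSingularSet.quarterLawTypeI_of_stub_uniformSparseness hS2) hν hT hmax hLH hdec

/-- **PED ∧ 0056 ∧ (∀ S2) ⟹ `NavierStokesRegularity`, by name** — what route EfficiencyFloor needs from the 1574 line
in registered vocabulary: `TypeIliouvilleNoTypeII` (stub 6) and `stub_uniformSparseness` (stub 2) give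
`EnstrophyQuarterLaw` (`Registered.enstrophyQuarterLaw_of_stubs`, S1 absorbed by stub 6), and the route's landed
assembly (`efficiencyFloor_assembly_proof` with the proved supports `FloorOfEfficiencyDecay`,
`BlowupEnstrophyUnbounded`) concludes. CONDITIONAL on three OPEN statements; nothing is asserted about any of them;
Navier–Stokes regularity is NOT proved here. [folklore] -/
theorem navierStokesRegularity_of_productionEfficiencyDecay_of_noTypeII_of_stub_uniformSparseness
    (hPED : Summit.NavierStokesRegularity.NavierStokesRegularity.Theses.EfficiencyFloor.ProductionEfficiencyDecay)
    (hS6 : Summit.NavierStokesRegularity.NavierStokesRegularity.Theses.TypeILiouville.TypeIliouvilleNoTypeII)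
    (hS2 : ∀ (ν T : ℝ), 0 < ν → 0 < T →
      ∀ (u : ℝ → EuclideanSpace ℝ (Fin 3) → EuclideanSpace ℝ (Fin 3))
        (p : ℝ → EuclideanSpace ℝ (Fin 3) → ℝ),
      IsMaximalSmoothSolution ν 0 u p T → IsLerayHopfOn T ν 0 (u 0) u →
      HasRapidSpatialDecay (u 0) → UniformSparseness T u) :
    _root_.NavierStokesRegularity := by
  have hQ := Registered.enstrophyQuarterLaw_of_stubs (Registered.stub_uniformLocalTypeI_of_stub_noTypeII hS6) hS2 hS6
  exact efficiencyFloor_assembly_proof hPED efficiencyFloor_floorOfEfficiencyDecay_proof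
    efficiencyFloor_blowupEnstrophyUnbounded_proof (fun ν T hν hT u p hmax hLH hdec => hQ ν T hν hT u p hmax hLH hdec)

end Summit.NavierStokesRegularity.NavierStokesRegularity.Theorems.ProductionEfficiencyDecay.TypeIIOnly

end
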